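import Summits.ResolutionOfSingularities.ResolutionOfSingularities.Theorems.MarkedTransferCampaignW12K12Box
import Summits.ResolutionOfSingularities.ResolutionOfSingularities.Theorems.MarkedTransferCampaignW13BypassCriteria
import Literature.AlgebraicGeometry.Hironaka2017.NegaWitness
import Literature.AlgebraicGeometry.Resolution.HasseSchmidtDerivatives
import Mathlib.RingTheory.MvPolynomial.Ideal
import HarnessLib

/-!
# [OURS · L1 W1.4 / K1.4] The elimination algebra (reading (A), «`℘(Ě) ∩ S[W]`») of the three G1 kernel
# witnesses: NON-TRIVIAL in degree one (kernel, typed algebraic `℘`), PROPER on generators at the singular point,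
# and the unit dichotomy on `Z₁` under negative-degree extensions (seat res-L1-k14, kill test K1.4)

LADDER-RESOLUTION rung L (rescue), cell `res-hironaka`, RESCUE-SEED §1 slot **W1.4** «ELIMINATION ALGEBRA INSTEAD OF
NEGATIVE MODULES» (kill-test-only slot, director-resolution 2026-08-27T00:42:40Z; K1.4 runs on READING (A) AS TYPED,
ruling 01:05:24Z (2)); host `--supports stmt-ResolutionOfSingularities-15522` (MarkedTransfer `HypersurfaceToMarked`,
the G1 campaign host) like the K1.2 files `MarkedTransferCampaignW12K12Box/Witnesses.lean`. PREREG
`L/res-L1-k14/PREREG-K1.4.md` (sha16 9d2e7caa508665d9); report `L/res-L1-k14/KILL-TEST-K1.4.md`; kit job j265389.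

HONEST FRAMING. Nothing here is a statement of H. Hironaka's manuscript (2017-03-23, [Hironaka2017]) nor of
Villamayor 2007 / Bravo–Villamayor 2010; nothing asserts that any printed statement holds. The objects are the tree's
REAL definitions — Grothendieck's `Resolution.diffIdeal` (EGA IV₄ 16.8), the typed ALGEBRAIC `℘` of row 003
`S04CharAlgebra.pAlgebraicRing` (U17_2, p.17 l.8–11; a CANDIDATE definition under adjudication) through its bound pieces
`Campaign.pAlgPiece K J b j` (W1.3 file), the sandwich modules `Campaign.sandwichPNega` (W1.2 file) — and EXPLICIT
polynomials over `𝔽₂`. Reading (A) of slot W1.4 (res-L1-type-o2's reserve typing `Campaign.elimAlgUpper`, not in the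
tree at the time of writing) is the envelope `℘(Ě) ∩ S[W]`; its degree-`k` piece along a base inclusion
`β* : S → O` is the contraction `(℘(Ě,k)).comap β*`, which is how it is written below (it is o2's `elimAlgPiece` for
`algebraMap S O = β*`, by o2's `elimAlgPiece_eq_comap`). Every theorem is elementary commutative algebra about these
objects (tag [folklore]); AI review is weaker than expert review; not progress on resolution of singularities. No
`sorry`; axioms standard.

## What is proved

§1 (schema, any rings) `comap_diffIdeal_le_elimPiece` — the degree-`(b−j)` GENERATORS `Diff^{(j)}(J)` of `℘(Ě)`
contract into the elimination piece; `apply_mem_elimPiece` — a value `D g`, `D` of order `≤ j < b`, `g ∈ J`, lying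
in the image of `β*` gives an element of the elimination piece (NON-TRIVIALITY pattern, K1.4 (i));
`comap_diffIdeal_le_of_le_pow` — at a point where `J ⊆ 𝔪^{j+1}` the generators contract into any ideal `𝔫 ⊇ β*⁻¹𝔪`
(PROPERNESS of the generators, K1.4 (iii-A), discharged); `elimPiece_le_of_piece_le` — the closure-level properness
as a one-line schema (its hypothesis `℘(Ě,k) ⊆ 𝔪` is the integral-closure step, supplied in the report by the
computation + Villamayor 2007 Th 4.11 (iii), NOT discharged here — said plainly).
§2 The three witnesses (`p = 2`): W1 `(y² + xw², 2) ⊂ 𝔸³` (tree `Nega.g3`), W2 `(y² + yω₁⁵ω₂ + yω₁ω₂ + ω₁⁴, 2) ⊂ 𝔸³`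
(tree `DiffProduct.ε`), W3 `(y² + yx⁴ + yx² + x⁴, 2) ⊂ 𝔸²`, projection `β` along `y`:
`W1_elim_one_mem` (`w² ∈ J_1`), `W2_elim_one_mem` (`a₁ = ω₁⁵ω₂ + ω₁ω₂ = ∂_y g₂ ∈ J_1` — the Artin–Schreier
coefficient that K1.2's box operator turned into a unit is a GENERATOR here), `W3_elim_one_mem` (`x⁴ + x² ∈ J_1`):
reading (A) is NON-TRIVIAL on all three (kit j265389 finds these generate `J_1` exactly: `(w²)`, `(ω₁ω₂u, ω₁⁵u)`,
`(x²(x+1)²)`).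
§3 (iii-B) — what a NEGATIVE-degree extension ON `Z₁` would do (reported row of K1.4, addressed to reading (C)):
ABSOLUTE operators of `Z₁` of order `2` manufacture a unit from each of the three degree-one generators
(`W1_Z1_absolute_unit`, `W2_Z1_absolute_unit`, `W3_Z1_absolute_unit` — the order criterion
`Resolution.diffIdeal_not_le_idealOfVars_of_not_le_pow_succ`, every characteristic, nothing to do with Frobenius);
the FROBENIUS-SANDWICH operators of `Z₁` reproduce K1.2's dichotomy one dimension down: NO unit from W1's and W3's
pieces, which are generated by squares (`W1_Z1_sandwich_noUnit`, `W3_Z1_sandwich_noUnit`, box criterion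
`Campaign.sandwichNegaNoUnit_of_frobPow`), a UNIT from W2's `a₁ = ω₁ω₂·(1 + ω₁⁴)` by the box operator `∂_{ω₁}∂_{ω₂}` of
order `2` (`W2_Z1_exists_boxOp`, `W2_Z1_sandwich_unit`). So «negative modules OF the elimination algebra» collapse
exactly as `℘nega` did; slot W1.4 = elimination algebra INSTEAD of negative modules (degrees `≥ 1` only) is untouched
by this — the verdict-bearing (iii-A) is §1's properness.

## References

* H. Hironaka, ms. 2017-03-23, §4 p.17 l.8–11 (U17_2), Def 5.1 p.25 — scope only, under adjudication. [Hironaka2017]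
* O. Villamayor U., Adv. Math. 213 (2007) = arXiv:math/0606796, Def 4.10, Th 4.11 p.22 (elimination algebra; `Ḡ`
  integral over `R_G`), §6.7 p.30; A. Bravo, O. Villamayor U., Adv. Math. 224 (2010) = arXiv:0807.4308, §2.7–2.9,
  Th 3.1 — scope of the slot, not cited as facts here. [Villamayor2007] [BravoVillamayor2010]
* A. Grothendieck, J. Dieudonné, ÉGA IV₄ §16.8, Thm 16.11.2 (tree `Resolution.DifferentialOperators`,
  `Resolution.HasseSchmidtDerivatives`). [EGAIV4]
* Cell res-hironaka: `L/res-L1-k14/KILL-TEST-K1.4.md`, kit j265389; K1.2 files p467586/p467948; barrier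
  `Literature.Barriers.ResolutionOfSingularities.BoxMonomialUnits` (p473522).
-/

noncomputable section

set_option linter.dupNamespace false -- mandated namespace of this single-conjunct summit

namespace Summit.ResolutionOfSingularities.ResolutionOfSingularities.Theorems.Campaign.W14

open Literature.AlgebraicGeometry.Resolution
open Literature.AlgebraicGeometry.Hironaka2017
open Summit.ResolutionOfSingularities.ResolutionOfSingularities.Theorems.Campaign
open MvPolynomial

universe u

/-! ## §1 Schema: generators of `℘(Ě)` contract into the elimination pieces; properness of the generators -/

section Schema

variable (K : Type u) [CommRing K] {S O : Type u} [CommRing S] [CommRing O] [Algebra K O]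

/-- The degree-`(b−j)` generators `Diff^{(j)}(J)`, `j < b`, of the typed algebraic `℘(Ě)` (row 003) contract along any
base map `β* : S → O` into the degree-`(b−j)` elimination piece `(℘(Ě,b−j)).comap β*` (reading (A) of slot W1.4 =
res-L1-type-o2's `elimAlgPiece` when `algebraMap S O = β*`). [folklore] -/
theorem comap_diffIdeal_le_elimPiece (β : S →+* O) (J : Ideal O) {b j : ℕ} (hj : j < b) :
    (diffIdeal K j J).comap β ≤ (pAlgPiece K J b (b - j)).comap β :=
  Ideal.comap_mono (W13.diffIdeal_le_pAlgPiece K J hj)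

/-- NON-TRIVIALITY PATTERN (K1.4 (i)): if `c ∈ S` maps under `β*` to a value `D g` of a `K`-linear differential operator
`D` of order `≤ j < b` on an element `g ∈ J`, then `c` lies in the degree-`(b−j)` elimination piece. [folklore] -/
theorem apply_mem_elimPiece (β : S →+* O) (J : Ideal O) {b j : ℕ} (hj : j < b) {D : O →ₗ[K] O}
    (hD : IsDiffOpLE K j D) {g : O} (hg : g ∈ J) {c : S} (hc : β c = D g) :
    c ∈ (pAlgPiece K J b (b - j)).comap β := by
  apply comap_diffIdeal_le_elimPiece K β J hj
  rw [Ideal.mem_comap, hc]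
  exact apply_mem_diffIdeal K hD hg

/-- PROPERNESS OF THE GENERATORS (K1.4 (iii-A), discharged half): at a point `𝔪 ⊆ O` with `J ⊆ 𝔪^{j+1}` (order `> j`),
the generators `Diff^{(j)}(J)` lie in `𝔪` (tree `diffIdeal_le_of_le_pow_succ`, every characteristic), hence contract
into any ideal `𝔫 ⊇ β*⁻¹(𝔪)` of `S` — no unit among the generators of any positive-degree elimination piece.
[folklore] -/
theorem comap_diffIdeal_le_of_le_pow (β : S →+* O) {J 𝔪 : Ideal O} {𝔫 : Ideal S} {j : ℕ}
    (hJ : J ≤ 𝔪 ^ (j + 1)) (h𝔫 : 𝔪.comap β ≤ 𝔫) : (diffIdeal K j J).comap β ≤ 𝔫 :=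
  (Ideal.comap_mono (diffIdeal_le_of_le_pow_succ K hJ)).trans h𝔫

/-- PROPERNESS AT CLOSURE LEVEL, schema (K1.4 (iii-A)): if the degree-`k` piece `℘(Ě,k)` lies in `𝔪` then the
elimination piece lies in every `𝔫 ⊇ β*⁻¹(𝔪)`. The hypothesis is the integral-closure step (`℘(Ě,k) ⊆ 𝔪_ξ^k` at a
point of `Sing`); it is NOT discharged in this file (the report supplies it by computation + Villamayor 2007
Th 4.11 (iii)). Same content as res-L1-type-o2's `CampaignW14.elimProperAt_of_piece_le`, comap form. [folklore] -/
theorem elimPiece_le_of_piece_le (β : S →+* O) {J 𝔪 : Ideal O} {𝔫 : Ideal S} {b k : ℕ}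
    (hk : pAlgPiece K J b k ≤ 𝔪) (h𝔫 : 𝔪.comap β ≤ 𝔫) : (pAlgPiece K J b k).comap β ≤ 𝔫 :=
  (Ideal.comap_mono hk).trans h𝔫

end Schema

/-! ## §2 The three G1 kernel witnesses: degree-one elimination elements (reading (A) is non-trivial) -/

section Witnesses

/-- `β*(X₀) = X₀` for the base inclusion `β* = rename ![0, 2] : 𝔽₂[X₀, X₁] → 𝔽₂[X₀, X₁, X₂]` (projection along
the fibre variable `X 1 = y`; W1: `x ↦ x`, W2: `ω₁ ↦ ω₁`). [folklore] -/
theorem βstar3_X0 : (rename ![(0 : Fin 3), 2]).toRingHom (X 0 : MvPolynomial (Fin 2) (ZMod 2)) = X 0 := by simp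

/-- `β*(X₁) = X₂` (W1: `w ↦ w`; W2: `ω₂ ↦ ω₂`). [folklore] -/
theorem βstar3_X1 : (rename ![(0 : Fin 3), 2]).toRingHom (X 1 : MvPolynomial (Fin 2) (ZMod 2)) = X 2 := by simp

/-- `β*(X₀) = X₀` for `β* = rename ![0] : 𝔽₂[X₀] → 𝔽₂[X₀, X₁]` (W3: `x ↦ x`, projection along `y = X 1`). [folklore] -/
theorem βstar2_X0 : (rename ![(0 : Fin 2)]).toRingHom (X 0 : MvPolynomial (Fin 1) (ZMod 2)) = X 0 := by simp

/-- `∂_x g = w²` for W1's `g = y² + xw²` (`Nega.g3`, frame `0 = x`, `1 = y`, `2 = w`; any characteristic). [folklore] -/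
theorem pderiv0_g1 : pderiv 0 Nega.g3 = X 2 ^ 2 := by
  simp [Nega.g3, Derivation.leibniz, Derivation.leibniz_pow, pderiv_X]

/-- `∂_y g₂ = a₁ = ω₁⁵ω₂ + ω₁ω₂` (characteristic `2`: `∂_y y² = 0`). [folklore] -/
theorem pderiv1_g2 : pderiv 1 (X 1 ^ 2 + DiffProduct.ε) = X 0 ^ 5 * X 2 + X 0 * X 2 := by
  have h2 : (2 : MvPolynomial (Fin 3) (ZMod 2)) = 0 := DiffProduct.two_eq_zero_A
  simp only [DiffProduct.ε, Derivation.leibniz, Derivation.leibniz_pow, map_add, pderiv_X, smul_eq_mul]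
  simp
  linear_combination (X 1 : MvPolynomial (Fin 3) (ZMod 2)) * h2

/-- `∂_y g₃ = x⁴ + x²` (characteristic `2`). [folklore] -/
theorem pderiv1_g3 :
    pderiv 1 (X 1 ^ 2 + X 1 * X 0 ^ 4 + X 1 * X 0 ^ 2 + X 0 ^ 4 : MvPolynomial (Fin 2) (ZMod 2)) = X 0 ^ 4 + X 0 ^ 2 := by
  have h2 : (2 : MvPolynomial (Fin 2) (ZMod 2)) = 0 := CharTwo.two_eq_zero
  have hsq : pderiv 1 (X 1 ^ 2 : MvPolynomial (Fin 2) (ZMod 2)) = 0 := by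
    rw [pderiv_pow, pderiv_X_self]; simp [h2]
  rw [map_add, map_add, map_add, hsq]
  simp [Derivation.leibniz, Derivation.leibniz_pow, pderiv_X]

/-- **W1, K1.4 (i) (kernel): `w² ∈ J_1(Ě_{W1}, β)`** — the degree-one elimination piece of `Ě = ((y² + xw²), 2)` along
the projection `β` off `y` contains `w²` (`= ∂_x g`, order `1 < 2`). Kit j265389: `J_1 = (w²)` exactly and
`℘(Ě) ∩ S[W] = 𝔽₂[x,w][w²·W]`. [folklore] -/
theorem W1_elim_one_mem :
    (X 1 ^ 2 : MvPolynomial (Fin 2) (ZMod 2)) ∈ (pAlgPiece (ZMod 2) (Ideal.span {Nega.g3}) 2 1).comap (rename ![(0 : Fin 3), 2]).toRingHom := by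
  have h := apply_mem_elimPiece (ZMod 2) (rename ![(0 : Fin 3), 2]).toRingHom (Ideal.span {Nega.g3}) (b := 2) (j := 1) (by norm_num)
    (Derivation.isDiffOpLE_one (pderiv 0)) (Ideal.mem_span_singleton_self _)
    (c := X 1 ^ 2) (by rw [map_pow, βstar3_X1, Derivation.coeFn_coe, pderiv0_g1])
  simpa using h

/-- **W2, K1.4 (i)/(iii-C) (kernel): `a₁ = ω₁⁵ω₂ + ω₁ω₂ ∈ J_1(Ě_{W2}, β)`** — the Artin–Schreier coefficient of the head
`g₂ = y² + a₁y + ω₁⁴` (the box monomial K1.2's operator turned into a unit, p467586) is an ELEMENT of the degree-one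
elimination piece (`a₁ = ∂_y g₂`; in characteristic `2` it is the trace, the degree-one universal elimination
invariant). Kit j265389: `J_1 = (ω₁ω₂u, ω₁⁵u)`, `u = 1 + ω₁⁴`, closure adds `ω₁³`. [folklore] -/
theorem W2_elim_one_mem :
    (X 0 ^ 5 * X 1 + X 0 * X 1 : MvPolynomial (Fin 2) (ZMod 2)) ∈ (pAlgPiece (ZMod 2) (Ideal.span {(X 1 ^ 2 + DiffProduct.ε : MvPolynomial (Fin 3) (ZMod 2))}) 2 1).comap
      (rename ![(0 : Fin 3), 2]).toRingHom := by
  have h := apply_mem_elimPiece (ZMod 2) (rename ![(0 : Fin 3), 2]).toRingHom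
    (Ideal.span {(X 1 ^ 2 + DiffProduct.ε : MvPolynomial (Fin 3) (ZMod 2))}) (b := 2) (j := 1) (by norm_num)
    (Derivation.isDiffOpLE_one (pderiv 1)) (Ideal.mem_span_singleton_self _)
    (c := X 0 ^ 5 * X 1 + X 0 * X 1)
    (by rw [map_add, map_mul, map_mul, map_pow, βstar3_X0, βstar3_X1, Derivation.coeFn_coe, pderiv1_g2])
  simpa using h

/-- **W3, K1.4 (i) (kernel): `x⁴ + x² ∈ J_1(Ě_{W3}, β)`** (`= ∂_y g₃`). Kit j265389: `J_1 = (x⁴ + x²)` = `(x²)` at the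
origin. [folklore] -/
theorem W3_elim_one_mem :
    (X 0 ^ 4 + X 0 ^ 2 : MvPolynomial (Fin 1) (ZMod 2)) ∈ (pAlgPiece (ZMod 2) (Ideal.span {(X 1 ^ 2 + X 1 * X 0 ^ 4 + X 1 * X 0 ^ 2 + X 0 ^ 4 : MvPolynomial (Fin 2) (ZMod 2))}) 2 1).comap
      (rename ![(0 : Fin 2)]).toRingHom := by
  have h := apply_mem_elimPiece (ZMod 2) (rename ![(0 : Fin 2)]).toRingHom
    (Ideal.span {(X 1 ^ 2 + X 1 * X 0 ^ 4 + X 1 * X 0 ^ 2 + X 0 ^ 4 : MvPolynomial (Fin 2) (ZMod 2))}) (b := 2) (j := 1) (by norm_num)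
    (Derivation.isDiffOpLE_one (pderiv 1)) (Ideal.mem_span_singleton_self _)
    (c := X 0 ^ 4 + X 0 ^ 2) (by rw [map_add, map_pow, map_pow, βstar2_X0, Derivation.coeFn_coe, pderiv1_g3])
  simpa using h

end Witnesses

/-! ## §3 (iii-B): negative-degree extensions on `Z₁` — absolute operators give units (order criterion),
sandwich operators give a unit exactly on W2 (box) -/

section Z1

/-- W1 on `Z₁ = Spec 𝔽₂[x,w]`: the ABSOLUTE operators of order `≤ 2` do not keep `(w²)` inside the maximal ideal of the
origin (`∂_w^{(2)} w² = 1`; order criterion, every characteristic). So a Def-5.1-shaped recipe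
`N ⊇ Diff^{(1+a)}_{Z₁}·J̄_1`, `a ≥ 1`, on the elimination algebra manufactures a unit on R04's witness. [folklore] -/
theorem W1_Z1_absolute_unit :
    ¬ diffIdeal (ZMod 2) 2 (Ideal.span {(X 1 ^ 2 : MvPolynomial (Fin 2) (ZMod 2))}) ≤ idealOfVars (Fin 2) (ZMod 2) := by
  classical
  refine diffIdeal_not_le_idealOfVars_of_not_le_pow_succ (ZMod 2) (m := 2) fun h => ?_
  have hmem := h (Ideal.mem_span_singleton_self (X 1 ^ 2 : MvPolynomial (Fin 2) (ZMod 2)))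
  rw [mem_pow_idealOfVars_iff'] at hmem
  have h0 := hmem (Finsupp.single 1 2) (by simp)
  rw [X_pow_eq_monomial, coeff_monomial] at h0
  simp at h0

/-- W2 on `Z₁ = Spec 𝔽₂[ω₁,ω₂]`: absolute operators of order `≤ 2` make a unit from `a₁` (`∂_{ω₁}∂_{ω₂} a₁ = 1 + ω₁⁴`).
[folklore] -/
theorem W2_Z1_absolute_unit :
    ¬ diffIdeal (ZMod 2) 2 (Ideal.span {(X 0 ^ 5 * X 1 + X 0 * X 1 : MvPolynomial (Fin 2) (ZMod 2))}) ≤ idealOfVars (Fin 2) (ZMod 2) := by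
  classical
  refine diffIdeal_not_le_idealOfVars_of_not_le_pow_succ (ZMod 2) (m := 2) fun h => ?_
  have hmem := h (Ideal.mem_span_singleton_self (X 0 ^ 5 * X 1 + X 0 * X 1 : MvPolynomial (Fin 2) (ZMod 2)))
  rw [mem_pow_idealOfVars_iff'] at hmem
  have h0 := hmem (Finsupp.single 0 1 + Finsupp.single 1 1) (by simp)
  have e1 : (X 0 ^ 5 * X 1 : MvPolynomial (Fin 2) (ZMod 2)) = monomial (Finsupp.single 0 5 + Finsupp.single 1 1) 1 := by
    rw [X_pow_eq_monomial, X, monomial_mul]; simp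
  have e2 : (X 0 * X 1 : MvPolynomial (Fin 2) (ZMod 2)) = monomial (Finsupp.single 0 1 + Finsupp.single 1 1) 1 := by
    rw [X, X, monomial_mul]; simp
  rw [e1, e2, coeff_add, coeff_monomial, coeff_monomial, if_neg, if_pos rfl] at h0
  · simp at h0
  · intro heq
    have := Finsupp.ext_iff.1 heq 0
    simp at this

/-- W3 on `Z₁ = Spec 𝔽₂[x]`: absolute operators of order `≤ 2` make a unit from `x⁴ + x²` (`∂_x^{(2)}(x⁴ + x²) = 1`).
[folklore] -/
theorem W3_Z1_absolute_unit :
    ¬ diffIdeal (ZMod 2) 2 (Ideal.span {(X 0 ^ 4 + X 0 ^ 2 : MvPolynomial (Fin 1) (ZMod 2))}) ≤ idealOfVars (Fin 1) (ZMod 2) := by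
  classical
  refine diffIdeal_not_le_idealOfVars_of_not_le_pow_succ (ZMod 2) (m := 2) fun h => ?_
  have hmem := h (Ideal.mem_span_singleton_self (X 0 ^ 4 + X 0 ^ 2 : MvPolynomial (Fin 1) (ZMod 2)))
  rw [mem_pow_idealOfVars_iff'] at hmem
  have h0 := hmem (Finsupp.single 0 2) (by simp)
  rw [X_pow_eq_monomial, X_pow_eq_monomial, coeff_add, coeff_monomial, coeff_monomial, if_neg, if_pos rfl] at h0
  · simp at h0
  · intro heq
    have := Finsupp.ext_iff.1 heq 0
    simp at this

/-- W1 on `Z₁`, FROBENIUS-SANDWICH operators (the W1.2 lever transplanted to `Z₁`): the family of pieces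
`d ↦ (w^{2d})` = the computed `℘(Ě_{W1}) ∩ S[W]` (kit j265389, degrees `≤ 4`; all degrees by `J_d = J_1^d`) is
UNIT-FREE in every negative degree, for every `m ≥ 1` — each piece is generated by a square (box criterion
`Campaign.sandwichNegaNoUnit_of_frobPow`). [folklore] -/
theorem W1_Z1_sandwich_noUnit (m : ℕ) (hm : 0 < m) :
    SandwichNegaNoUnit 2 1 (fun d => Ideal.span {(X 1 : MvPolynomial (Fin 2) (ZMod 2)) ^ (2 * d)}) m := by
  refine sandwichNegaNoUnit_of_frobPow 2 1 _ m fun d hd => ?_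
  rw [Ideal.span_singleton_le_iff_mem]
  have hdm : 0 < d * m := Nat.mul_pos hd hm
  have : (X 1 : MvPolynomial (Fin 2) (ZMod 2)) ^ (2 * (d * m)) = (X 1 ^ (2 ^ 1)) * X 1 ^ (2 * (d * m) - 2) := by
    rw [← pow_add]; congr 1; omega
  rw [this]
  exact Ideal.mul_mem_right _ _ (Ideal.subset_span ⟨1, rfl⟩)

/-- W3 on `Z₁ = Spec 𝔽₂[x]`, sandwich operators: the family `d ↦ ((x⁴ + x²)^d)` = the computed `℘(Ě_{W3}) ∩ S[W]` is
UNIT-FREE in every negative degree (`x⁴ + x² = x²(x² + 1)` is a multiple of a square). [folklore] -/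
theorem W3_Z1_sandwich_noUnit (m : ℕ) (hm : 0 < m) :
    SandwichNegaNoUnit 2 1 (fun d => Ideal.span {(X 0 ^ 4 + X 0 ^ 2 : MvPolynomial (Fin 1) (ZMod 2)) ^ d}) m := by
  refine sandwichNegaNoUnit_of_frobPow 2 1 _ m fun d hd => ?_
  rw [Ideal.span_singleton_le_iff_mem]
  have hdm : 0 < d * m := Nat.mul_pos hd hm
  obtain ⟨e, he⟩ := Nat.exists_eq_succ_of_ne_zero hdm.ne'
  rw [he, pow_succ]
  refine Ideal.mul_mem_left _ _ ?_
  have : (X 0 ^ 4 + X 0 ^ 2 : MvPolynomial (Fin 1) (ZMod 2)) = X 0 ^ (2 ^ 1) * (X 0 ^ 2 + 1) := by ring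
  rw [this]
  exact Ideal.mul_mem_right _ _ (Ideal.subset_span ⟨0, rfl⟩)

/-- W2 on `Z₁ = Spec 𝔽₂[ω₁,ω₂]`: THE BOX OPERATOR ONE DIMENSION DOWN. `∂_{ω₁}∂_{ω₂}` is linear over the subring of squares
(a composite of two derivations over `ρ(S)`, Grothendieck order `≤ 2`) and sends `a₁ = ω₁⁵ω₂ + ω₁ω₂` to `ω₁⁴ + 1`.
[folklore] -/
theorem W2_Z1_exists_boxOp :
    ∃ D : MvPolynomial (Fin 2) (ZMod 2) →ₗ[(iterateFrobenius (MvPolynomial (Fin 2) (ZMod 2)) 2 1).range] MvPolynomial (Fin 2) (ZMod 2),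
      IsDiffOpLE ((iterateFrobenius (MvPolynomial (Fin 2) (ZMod 2)) 2 1).range) 2 D ∧ D (X 0 ^ 5 * X 1 + X 0 * X 1) = X 0 ^ 4 + 1 := by
  obtain ⟨δ, hδ⟩ : ∃ δ : Fin 2 → Derivation ((iterateFrobenius (MvPolynomial (Fin 2) (ZMod 2)) 2 1).range) (MvPolynomial (Fin 2) (ZMod 2)) (MvPolynomial (Fin 2) (ZMod 2)), ∀ i f, δ i f = pderiv i f :=
    ⟨fun i =>
      { toFun := pderiv i
        map_add' := map_add _
        map_smul' := by
          rintro ⟨r, h, rfl⟩ f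
          simp only [Subring.smul_def, smul_eq_mul, RingHom.id_apply, iterateFrobenius_def, pow_one]
          rw [(pderiv i).leibniz, (pderiv i).leibniz_pow]
          simp only [smul_eq_mul, two_nsmul]
          rw [CharTwo.add_self_eq_zero, mul_zero, add_zero]
        map_one_eq_zero' := (pderiv i).map_one_eq_zero
        leibniz' := fun a b => (pderiv i).leibniz a b }, fun _ _ => rfl⟩
  have hc := (Derivation.isDiffOpLE_one (δ 0)).comp (Derivation.isDiffOpLE_one (δ 1))
  refine ⟨_, hc, ?_⟩
  simp only [LinearMap.coe_comp, Function.comp_apply, Derivation.coeFn_coe, hδ]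
  have h5 : (5 : MvPolynomial (Fin 2) (ZMod 2)) = 1 := DiffProduct.five_eq_one_R'
  simp [Derivation.leibniz, Derivation.leibniz_pow, pderiv_X, h5]

/-- `ω₁⁴ + 1 ∉ 𝔫₀`: a unit at the origin of `Z₁`. [folklore] -/
theorem X0_pow_four_add_one_not_mem_S2 : (X 0 ^ 4 + 1 : MvPolynomial (Fin 2) (ZMod 2)) ∉ idealOfVars (Fin 2) (ZMod 2) := by
  intro h
  rw [← pow_one (idealOfVars (Fin 2) (ZMod 2)), mem_pow_idealOfVars_iff'] at h
  have h0 := h 0 (by simp)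
  simp [coeff_add, coeff_X_pow] at h0

/-- **W2 on `Z₁`, sandwich operators — the BoxMonomialUnits mechanism RE-APPEARS (kernel).** For EVERY family `Q` of
pieces on `Z₁` whose degree-one piece contains `a₁ = ω₁⁵ω₂ + ω₁ω₂` (true of the computed `℘(Ě_{W2}) ∩ S[W]`,
`W2_elim_one_mem`), the Frobenius-sandwich negative module of degree `−1` built with `m = 1`
(`Diff^{(2)}_{S/ρ(S)}·Q(1) ⊆ N(−1)`) is NOT inside the maximal ideal of `β(ξ) = 0`: the box operator `∂_{ω₁}∂_{ω₂}` of
order `2 ≤ m + a` makes the unit `ω₁⁴ + 1`. K1.2's death (p467586 `W2_sandwichPNega_not_le`) verbatim one dimension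
down; it concerns negative-degree EXTENSIONS only — slot W1.4 (reading (A), degrees `≥ 1`) builds none. [folklore] -/
theorem W2_Z1_sandwich_unit (Q : ℕ → Ideal (MvPolynomial (Fin 2) (ZMod 2))) (ha : (X 0 ^ 5 * X 1 + X 0 * X 1 : MvPolynomial (Fin 2) (ZMod 2)) ∈ Q 1) :
    ¬ sandwichPNega 2 1 Q 1 1 ≤ idealOfVars (Fin 2) (ZMod 2) := by
  obtain ⟨D, hD, hDa⟩ := W2_Z1_exists_boxOp
  exact not_sandwichPNega_le 2 1 Q (by norm_num) (le_refl 1) _ D hD ha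
    (by rw [hDa]; exact X0_pow_four_add_one_not_mem_S2)

end Z1

end Summit.ResolutionOfSingularities.ResolutionOfSingularities.Theorems.Campaign.W14

end
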